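import Mathlib.RingTheory.Localization.FractionRing
import Mathlib.RingTheory.Localization.Integer
import Mathlib.RingTheory.MvPolynomial.Basic
import Mathlib.Algebra.MvPolynomial.Equiv
import Mathlib.Algebra.Polynomial.Lifts

/-!
# `PairwiseCurvedTilingsLC` (crux stmt-MatrixMultiplication-17883), line LonelyTranslates (c1):
clearing denominators (helper S1 of the generic-simple-roots step `stub_relGen`)

Pure commutative algebra.  Coordinates are split into free ones `u ∈ K^e` and bound ones
`w ∈ K^k`; `R = K[u] = MvPolynomial (Fin e) K`, `F = Frac R`.  The canonical `K`-algebra map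
`toFw : K[u, w] = MvPolynomial (Fin e ⊕ Fin k) K → F[w] = MvPolynomial (Fin k) F` sends
`u_i ↦ C (u_i / 1)` and `w_j ↦ w_j`.  We prove:

* `mem_range_of_coeff_mem_range` — a polynomial of `F[w]` all of whose `F`-coefficients come from
  `R` is in the image of `toFw` (stated for any `K`-algebra map `f` with the two defining values
  on the variables, over any `K`-algebra `F` under `R`);
* `stub_clearDenominators` — finitely many `P_i ∈ F[w][s]` have a common denominator
  `b ∈ R ∖ 0`: each `b · P_i` is the image of some `P₀ ∈ K[u, w][s]` under `Polynomial.map toFw`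
  (`IsLocalization.exist_integer_multiples_of_finset` on the finite set of all coefficients, then
  `Polynomial.lifts_iff_coeff_lifts`).
-/

set_option linter.dupNamespace false  -- `Summit.<S>.<S>.…` is the mandated namespace

namespace Summit.MatrixMultiplication.MatrixMultiplication.Theorems.PairwiseCurvedTilingsLC.Negative

open MvPolynomial

/-- **The image of `K[u, w] → F[w]` contains every polynomial with coefficients from `R = K[u]`.**
Let `f : MvPolynomial (σ ⊕ τ) K →ₐ[K] MvPolynomial τ F` be a `K`-algebra map with
`f (X (inl i)) = C (algebraMap R F (X i))` and `f (X (inr j)) = X j`, where `F` is an `R`-algebra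
compatibly with `K`.  If every coefficient of `q ∈ F[w]` lies in the image of `algebraMap R F`,
then `q` lies in the image of `f`. -/
theorem mem_range_of_coeff_mem_range {K : Type} [CommRing K] {σ τ : Type} {F : Type} [CommRing F]
    [Algebra K F] [Algebra (MvPolynomial σ K) F] [IsScalarTower K (MvPolynomial σ K) F]
    (f : MvPolynomial (σ ⊕ τ) K →ₐ[K] MvPolynomial τ F)
    (hfl : ∀ i, f (X (Sum.inl i)) = C (algebraMap (MvPolynomial σ K) F (X i)))
    (hfr : ∀ j, f (X (Sum.inr j)) = X j) (q : MvPolynomial τ F)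
    (hq : ∀ m, coeff m q ∈ Set.range (algebraMap (MvPolynomial σ K) F)) :
    q ∈ Set.range f := by
  classical
  -- `f` on polynomials in the free variables only
  have hC : ∀ r : MvPolynomial σ K, f (rename Sum.inl r) = C (algebraMap (MvPolynomial σ K) F r) := by
    intro r
    induction r using MvPolynomial.induction_on with
    | C c =>
      rw [rename_C, ← MvPolynomial.algebraMap_eq, AlgHom.commutes, MvPolynomial.algebraMap_apply,
        IsScalarTower.algebraMap_apply K (MvPolynomial σ K) F c, MvPolynomial.algebraMap_eq]
    | add p q hp hq => rw [map_add, map_add, hp, hq, map_add, map_add]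
    | mul_X p i hp => rw [map_mul, rename_X, map_mul, hp, hfl, map_mul, C_mul]
  -- `f` on polynomials in the bound variables only
  have hX : ∀ p : MvPolynomial τ K, f (rename Sum.inr p) = map (algebraMap K F) p := by
    intro p
    induction p using MvPolynomial.induction_on with
    | C c =>
      rw [rename_C, ← MvPolynomial.algebraMap_eq, AlgHom.commutes, MvPolynomial.algebraMap_apply,
        map_C]
    | add p q hp hq => rw [map_add, map_add, hp, hq, map_add]
    | mul_X p i hp => rw [map_mul, rename_X, map_mul, hp, hfr, map_mul, map_X]
  -- every monomial of `q` is in the range, hence so is `q`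
  suffices h : q ∈ f.range from (AlgHom.mem_range f).1 h
  rw [as_sum q]
  refine Subalgebra.sum_mem _ fun m _ => (AlgHom.mem_range f).2 ?_
  obtain ⟨r, hr⟩ := hq m
  refine ⟨rename Sum.inl r * rename Sum.inr (monomial m 1), ?_⟩
  rw [map_mul, hC, hX, map_monomial, map_one, C_mul_monomial, mul_one, hr]

/-- STUB S1 (helper, clearing denominators) for line LonelyTranslates of crux
stmt-MatrixMultiplication-17883.  Finitely many polynomials over `F[w]`, `F = Frac K[u]`, have a
common denominator `b ∈ K[u] ∖ 0`: `b · P_i` is the image of a polynomial over `K[u, w]` under the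
canonical map `K[u,w] → F[w]` (`u_i ↦ u_i/1`, `w_j ↦ w_j`). -/
theorem stub_clearDenominators {K : Type} [Field K] {e k : ℕ} {ι : Type} [Finite ι]
    (P : ι → Polynomial (MvPolynomial (Fin k) (FractionRing (MvPolynomial (Fin e) K)))) :
    ∃ b : MvPolynomial (Fin e) K, b ≠ 0 ∧ ∀ i, ∃ P₀ : Polynomial (MvPolynomial (Fin e ⊕ Fin k) K),
      P₀.map (MvPolynomial.aeval (Sum.elim
          (fun i => MvPolynomial.C (algebraMap (MvPolynomial (Fin e) K)
            (FractionRing (MvPolynomial (Fin e) K)) (MvPolynomial.X i)))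
          (fun j => MvPolynomial.X j)) :
            MvPolynomial (Fin e ⊕ Fin k) K →ₐ[K]
              MvPolynomial (Fin k) (FractionRing (MvPolynomial (Fin e) K))).toRingHom
        = Polynomial.C (MvPolynomial.C (algebraMap (MvPolynomial (Fin e) K)
            (FractionRing (MvPolynomial (Fin e) K)) b)) * P i := by
  classical
  haveI := Fintype.ofFinite ι
  -- the canonical map and its values on the variables
  set f : MvPolynomial (Fin e ⊕ Fin k) K →ₐ[K]
      MvPolynomial (Fin k) (FractionRing (MvPolynomial (Fin e) K)) :=
    MvPolynomial.aeval (Sum.elim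
      (fun i => MvPolynomial.C (algebraMap (MvPolynomial (Fin e) K)
        (FractionRing (MvPolynomial (Fin e) K)) (MvPolynomial.X i)))
      (fun j => MvPolynomial.X j)) with hf
  have hfl : ∀ i, f (X (Sum.inl i)) = C (algebraMap (MvPolynomial (Fin e) K)
      (FractionRing (MvPolynomial (Fin e) K)) (X i)) := fun i => by
    rw [hf, aeval_X, Sum.elim_inl]
  have hfr : ∀ j, f (X (Sum.inr j)) = X j := fun j => by
    rw [hf, aeval_X, Sum.elim_inr]
  -- the finite set of all `F`-coefficients of all the `P i`
  let S : Finset (FractionRing (MvPolynomial (Fin e) K)) :=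
    Finset.univ.biUnion fun i => (P i).support.biUnion fun n =>
      ((P i).coeff n).support.image fun m => coeff m ((P i).coeff n)
  obtain ⟨b, hb⟩ := IsLocalization.exist_integer_multiples_of_finset
    (nonZeroDivisors (MvPolynomial (Fin e) K)) S
  refine ⟨b, nonZeroDivisors.coe_ne_zero b, fun i => ?_⟩
  -- all coefficients of `b · P i` are integers, so `b · P i` lifts
  have key : Polynomial.C (C (algebraMap (MvPolynomial (Fin e) K)
      (FractionRing (MvPolynomial (Fin e) K)) (b : MvPolynomial (Fin e) K))) * P i ∈
        Polynomial.lifts f.toRingHom := by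
    rw [Polynomial.lifts_iff_coeff_lifts]
    intro n
    rw [Polynomial.coeff_C_mul]
    refine mem_range_of_coeff_mem_range f hfl hfr _ fun m => ?_
    rw [coeff_C_mul, ← Algebra.smul_def]
    by_cases h0 : coeff m ((P i).coeff n) = 0
    · rw [h0, smul_zero]
      exact ⟨0, map_zero _⟩
    · refine hb _ ?_
      simp only [S, Finset.mem_biUnion, Finset.mem_univ, true_and, Finset.mem_image,
        Polynomial.mem_support_iff, MvPolynomial.mem_support_iff]
      refine ⟨i, n, fun hn => h0 ?_, m, h0, rfl⟩
      rw [hn, coeff_zero]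
  exact (Polynomial.mem_lifts _).1 key

end Summit.MatrixMultiplication.MatrixMultiplication.Theorems.PairwiseCurvedTilingsLC.Negative
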